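import Summits.Ventures.Crystal3D.Theorems.StickyWulffConstantGenericWallFloorConeCertificateFanB
import HarnessLib

/-!
# FAN cone certificates: a fan of tangent test directions per free ball (×1.28–1.39 larger tube radii) — part C (the tube theorems)

Helper for `stmt-Ventures-19480` (E1 inside-tube half; lit g12, LIT §36(D)).  The landed `ConeCert`
tests the first-order margin in the four signed directions `±τ₀, ±τ₁` of an integer orthogonal tangent
frame and loses the covering constant `1/√2` (every tangent `w` is within `45°` of one of them).  A
`FanCert` carries, per free ball, LP certificates for a FAN of integer directions
`±α_k τ₀ ± β_k τ₁`, `(α_k, β_k)` running from `(1,0)` to `(0,1)` with increasing slope; every tangent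
`w` lies in the cone of two CONSECUTIVE signed directions (`fan_coeffs`: sign flags put `w` in the first
quadrant, a discrete intermediate-value step finds the sector), and for the better of the two,
`cover_two` — purely algebraic: `W = xP + yQ`, `x, y ≥ 0` ⇒ `max(Ŵ·P̂, Ŵ·Q̂)² ≥ (1 + P̂·Q̂)/2` — gives
`Cd ‖w‖² ‖D‖² ≤ Cn ⟪w, D⟫²` with the certificate's rational covering constant `c² ≥ Cd/Cn`, checked in
integers per consecutive pair (`(2Cd − Cn)² |D_k|²|D_k'|² ≤ Cn² (D_k·D_k')²`, `D_k·D_l = α_kα_l|τ₀|² +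
β_kβ_l|τ₁|²`).  Own contacts are in the OBSTACLE-general form `2·slot·P = P·P` (unit own balls:
`P·P = N`), second-order weight `B_N = Σ_own λ (P·P) + 6N Λ_free`, and the per-ball radius check is
`ρ_i² (Cn B_N² + 4N Cd r² |D|²) ≤ 16 N Cd r² |D|²` for every fan direction `D` at ball `i`
(`FanCert.rhoCheckAt`; for `Cn/Cd = 2` and an orthogonal pair this is the landed `rhoCheck`).
THEOREMS: `FanCert.eq_slots_rhoAt` / `eq_slots_fanRhoAt_dist` (check ∧ ∀ i, rhoCheckAt i (p i) q ⇒ every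
admissible completion with ball `i` within chord `p i / q` of slot `i` IS the slot configuration),
`FanCert.eq_slotSet_of_slotMatched` (finset form in the `SlotMatched` currency of
`…ConeCertificateRhoPerBall`, feeding `exactOnly_of_slotTube_and_exhaustion`).
NUMBERS (exact, `cert/gencert_fan.py`, K = 12 directions, Cd/Cn = 9866/10000; kernel-checked data files
`…ConeCertFan{Fcc55,Hcp451,Hcp1743,Hcp1735,Hcp615,Hcp719,Hcp1739}`), per-ball radii FAN vs the landed per-ball
`…ConeCertRhoAt*` (orthogonal pair): C12-55 (0.104, 0.193, 0.193, 0.104, 0.193, 0.193, 0.280) vs (0.074, 0.141, 0.141,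
0.074, 0.141, 0.141, 0.201); A12-451 (0.144, 0.152, 0.152, 0.144, 0.147, 0.135, 0.135) vs (0.108, 0.115, 0.115, 0.108,
0.106, 0.096, 0.133); A12-1743 (0.393, 0.393, 0.204, 0.204) vs (0.282, 0.282, 0.145, 0.167); A12-1735 (0.241, 0.280,
0.256, 0.175, 0.175) vs (0.175, 0.201, 0.199, 0.127, 0.132); A12-615 (0.280, 0.280, 0.153, 0.153, 0.153, 0.153) vs
(0.201, 0.201, 0.114, 0.114, 0.114, 0.125); A12-719 min 0.161 vs 0.119; A12-1739 min 0.204 vs 0.145 (×1.35–1.41 on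
the binding ball).  lit g12 (crystal3d-full; HOME/cf-lit/lean/conecert-fan/).

WHAT THIS IS NOT: the exhaustion outside the tube (eng lineage B / cf-p2 lineage A); rung F-C1 not moved.
-/

noncomputable section

namespace Summit.Ventures.Crystal3D.Theorems

open Finset Literature.Geometry.DiscreteGeometry
open scoped RealInnerProductSpace

namespace FanCert

variable {m : ℕ} (C : FanCert m)

/-- **Exact capping inside the PER-BALL FAN tube.**  For a valid fan certificate and per-ball radii
`p i / q` passing `rhoCheckAt i (p i) q`: every admissible completion `x` (unit vectors with
`⟪x i, o⟫ ≤ ‖o‖²/2` at every listed own/obstacle centre `o`, `⟪x i, x j⟫ ≤ 1/2` at the active free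
pairs) with each ball `i` within chord `p i / q` of its slot IS the slot configuration. -/
theorem eq_slots_rhoAt (hV : C.check = true) {p : Fin m → ℕ} {q : ℕ}
    (hρ : ∀ i, C.rhoCheckAt i (p i) q = true)
    {x : Fin m → (EuclideanSpace ℝ (Fin 3))} (hx : ∀ i, ‖x i‖ = 1)
    (hxo : ∀ i, ∀ o ∈ C.ownSet, ⟪C.s i, o⟫ = ‖o‖ ^ 2 / 2 → ⟪x i, o⟫ ≤ ‖o‖ ^ 2 / 2)
    (hxx : ∀ i j, i ≠ j → ⟪C.s i, C.s j⟫ = 1 / 2 → ⟪x i, x j⟫ ≤ 1 / 2)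
    (hclose : ∀ i, ‖x i - C.s i‖ < (p i : ℝ) / q) : x = C.s := by
  classical
  obtain ⟨hN, -, hCn, hCd, -, hown, hfree, htan, -, -, hcert⟩ := C.check_spec hV
  have hsqpos := (Real.sqrt_pos.2 (by exact_mod_cast hN) : (0:ℝ) < Real.sqrt C.N)
  have hsqN : Real.sqrt (C.N : ℝ) ^ 2 = C.N := Real.sq_sqrt (by positivity)
  have hNpos : (0 : ℝ) < C.N := by exact_mod_cast hN
  have hCdR : (0 : ℝ) < C.Cd := by exact_mod_cast hCd
  have hCnR : (0 : ℝ) < C.Cn := by exact_mod_cast hCn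
  -- displacement, its maximum, tangent parts
  set v : Fin m → (EuclideanSpace ℝ (Fin 3)) :=
    fun i => (x i - C.s i) + (‖x i - C.s i‖ ^ 2 / 2) • C.s i with hvdef
  have hvt : ∀ i, ⟪v i, C.s i⟫ = 0 := fun i => inner_tangentPart_eq_zero (C.norm_s_eq_one i hV) (hx i)
  rcases isEmpty_or_nonempty (Fin m) with hι | hι
  · funext i; exact (hι.false i).elim
  obtain ⟨i₀, hi₀⟩ := Finite.exists_max fun i => ‖x i - C.s i‖
  set ε := ‖x i₀ - C.s i₀‖ with hεdef
  have hε0 : 0 ≤ ε := norm_nonneg _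
  have hεi : ∀ i, ‖x i - C.s i‖ ≤ ε := hi₀
  have hερ : ε < (p i₀ : ℝ) / q := hclose i₀
  have hvsq : ‖v i₀‖ ^ 2 = ε ^ 2 - ε ^ 4 / 4 := norm_tangentPart_sq (C.norm_s_eq_one i₀ hV) (hx i₀)
  -- tangency in integer form and the fan direction at i₀
  have hvI : ∀ i, ⟪v i, intVec (C.slot i)⟫ = 0 := by
    intro i
    have h := hvt i
    rw [FanCert.s, real_inner_smul_right] at h
    rcases mul_eq_zero.1 h with h | h
    · exact absurd h (inv_pos.2 hsqpos).ne'
    · exact h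
  obtain ⟨k, s0, s1, ht0, hcov, hDne⟩ := C.exists_fan_dir hV i₀ (v i₀) (hvI i₀)
  obtain ⟨hr, hid⟩ := hcert i₀ k s0 s1
  -- the per-ball check at i₀
  have hρ₀ := hρ i₀
  unfold FanCert.rhoCheckAt at hρ₀
  obtain ⟨hrden, -, hrho⟩ := of_decide_eq_true hρ₀
  have hrhoR := hrho k s0 s1
  have hnD : (dotInt (C.dir i₀ k s0 s1) (C.dir i₀ k s0 s1) : ℝ) = ‖intVec (C.dir i₀ k s0 s1)‖ ^ 2 := by
    rw [← real_inner_self_eq_norm_sq, inner_intVec]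
  generalize hDg : intVec (C.dir i₀ k s0 s1) = D at ht0 hcov hDne hnD
  set t : ℝ := ⟪v i₀, D⟫ with ht
  have hDpos : 0 < ‖D‖ ^ 2 := by have := norm_pos_iff.2 hDne; positivity
  -- Σ_c λ_c L̃_c(v) = r · t
  have hsum : (∑ c : Fin C.nO, (C.lamO i₀ k s0 s1 c : ℝ) * ⟪v (C.ownBall c), intVec (C.ownVec c)⟫) +
      ∑ c : Fin C.nF, (C.lamF i₀ k s0 s1 c : ℝ) *
        (⟪v (C.freeA c), intVec (C.slot (C.freeB c))⟫ +
          ⟪v (C.freeB c), intVec (C.slot (C.freeA c))⟫) = (C.r i₀ k s0 s1 : ℝ) * t := by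
    rw [← C.sum_inner_grad i₀ k s0 s1 v]
    have : ∀ i, ⟪v i, intVec (C.grad i₀ k s0 s1 i)⟫ =
        if i = i₀ then (C.r i₀ k s0 s1 : ℝ) * t else 0 := by
      intro i
      rw [hid i, intVec_add, inner_add_right, intVec_zsmul, real_inner_smul_right, hvI i, mul_zero,
        zero_add]
      split_ifs with h
      · subst h; rw [intVec_zsmul, real_inner_smul_right, hDg, ht]; push_cast; ring
      · rw [intVec_zero, inner_zero_right]
    simp_rw [this]
    rw [Finset.sum_ite_eq' Finset.univ i₀]; simp
  -- second-order upper bounds (own/obstacle: (P·P)/(4√N) ε², free: √N (3/2) ε²)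
  have hownb : ∀ c : Fin C.nO,
      ⟪v (C.ownBall c), intVec (C.ownVec c)⟫ ≤
        (dotInt (C.ownVec c) (C.ownVec c) : ℝ) / (4 * Real.sqrt C.N) * ε ^ 2 := by
    intro c
    set o : (EuclideanSpace ℝ (Fin 3)) := (Real.sqrt C.N)⁻¹ • intVec (C.ownVec c) with hodef
    have ho : o ∈ C.ownSet := Finset.mem_image_of_mem _ (Finset.mem_univ c)
    have hso : ⟪C.s (C.ownBall c), o⟫ = ‖o‖ ^ 2 / 2 := C.inner_s_obs hN c (hown c)
    have heq : intVec (C.ownVec c) = Real.sqrt C.N • o := by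
      rw [hodef, smul_smul, mul_inv_cancel₀ hsqpos.ne', one_smul]
    have hoo : ‖o‖ ^ 2 = (dotInt (C.ownVec c) (C.ownVec c) : ℝ) / C.N := by
      have hPP : ‖intVec (C.ownVec c)‖ ^ 2 = (dotInt (C.ownVec c) (C.ownVec c) : ℝ) := by
        rw [← real_inner_self_eq_norm_sq, inner_intVec]
      rw [hodef, norm_smul, norm_inv, Real.norm_of_nonneg hsqpos.le, mul_pow, inv_pow, hPP, hsqN]
      field_simp
    have h1 : ⟪v (C.ownBall c), o⟫ ≤ ‖x (C.ownBall c) - C.s (C.ownBall c)‖ ^ 2 * ‖o‖ ^ 2 / 4 :=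
      inner_tangentPart_obstacle_le hso (hxo _ o ho hso)
    have h2 : ‖x (C.ownBall c) - C.s (C.ownBall c)‖ ^ 2 ≤ ε ^ 2 :=
      pow_le_pow_left₀ (norm_nonneg _) (hεi _) 2
    have h3 : ⟪v (C.ownBall c), o⟫ ≤ ε ^ 2 * ‖o‖ ^ 2 / 4 := by
      have : ‖x (C.ownBall c) - C.s (C.ownBall c)‖ ^ 2 * ‖o‖ ^ 2 ≤ ε ^ 2 * ‖o‖ ^ 2 :=
        mul_le_mul_of_nonneg_right h2 (sq_nonneg _)
      linarith
    rw [heq, real_inner_smul_right]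
    calc Real.sqrt C.N * ⟪v (C.ownBall c), o⟫ ≤ Real.sqrt C.N * (ε ^ 2 * ‖o‖ ^ 2 / 4) :=
          mul_le_mul_of_nonneg_left h3 hsqpos.le
      _ = (dotInt (C.ownVec c) (C.ownVec c) : ℝ) / (4 * Real.sqrt C.N) * ε ^ 2 := by
          rw [hoo]; field_simp; rw [hsqN]; ring
  have hfreeb : ∀ c : Fin C.nF,
      ⟪v (C.freeA c), intVec (C.slot (C.freeB c))⟫ + ⟪v (C.freeB c), intVec (C.slot (C.freeA c))⟫ ≤
        Real.sqrt C.N * (3 / 2 * ε ^ 2) := by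
    intro c
    have hss : ⟪C.s (C.freeA c), C.s (C.freeB c)⟫ = 1 / 2 := C.inner_freeA_freeB c hN (hfree c).2
    have heqA : intVec (C.slot (C.freeA c)) = Real.sqrt C.N • C.s (C.freeA c) := by
      rw [FanCert.s, smul_smul, mul_inv_cancel₀ hsqpos.ne', one_smul]
    have heqB : intVec (C.slot (C.freeB c)) = Real.sqrt C.N • C.s (C.freeB c) := by
      rw [FanCert.s, smul_smul, mul_inv_cancel₀ hsqpos.ne', one_smul]
    have h1 := inner_tangentPart_free_le hss (hxx _ _ (hfree c).1 hss)
    have h2 : ‖x (C.freeA c) - C.s (C.freeA c)‖ ^ 2 ≤ ε ^ 2 :=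
      pow_le_pow_left₀ (norm_nonneg _) (hεi _) 2
    have h3 : ‖x (C.freeB c) - C.s (C.freeB c)‖ ^ 2 ≤ ε ^ 2 :=
      pow_le_pow_left₀ (norm_nonneg _) (hεi _) 2
    have h4 : ‖x (C.freeA c) - C.s (C.freeA c)‖ * ‖x (C.freeB c) - C.s (C.freeB c)‖ ≤ ε * ε :=
      mul_le_mul (hεi _) (hεi _) (norm_nonneg _) hε0
    rw [heqA, heqB, real_inner_smul_right, real_inner_smul_right,
      real_inner_comm (C.s (C.freeA c)) (v (C.freeB c)), ← mul_add]
    refine mul_le_mul_of_nonneg_left ?_ hsqpos.le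
    have : ⟪v (C.freeA c), C.s (C.freeB c)⟫ + ⟪C.s (C.freeA c), v (C.freeB c)⟫ ≤
        ε * ε + (ε ^ 2 + ε ^ 2) / 4 := by
      refine h1.trans ?_; nlinarith
    nlinarith
  have hup : (∑ c : Fin C.nO, (C.lamO i₀ k s0 s1 c : ℝ) * ⟪v (C.ownBall c), intVec (C.ownVec c)⟫) +
      ∑ c : Fin C.nF, (C.lamF i₀ k s0 s1 c : ℝ) *
        (⟪v (C.freeA c), intVec (C.slot (C.freeB c))⟫ +
          ⟪v (C.freeB c), intVec (C.slot (C.freeA c))⟫) ≤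
      (C.BN i₀ k s0 s1 : ℝ) / (4 * Real.sqrt C.N) * ε ^ 2 := by
    have ho : ∑ c : Fin C.nO, (C.lamO i₀ k s0 s1 c : ℝ) * ⟪v (C.ownBall c), intVec (C.ownVec c)⟫ ≤
        ∑ c : Fin C.nO, (C.lamO i₀ k s0 s1 c : ℝ) *
          ((dotInt (C.ownVec c) (C.ownVec c) : ℝ) / (4 * Real.sqrt C.N) * ε ^ 2) :=
      Finset.sum_le_sum fun c _ => mul_le_mul_of_nonneg_left (hownb c) (by positivity)
    have hf : ∑ c : Fin C.nF, (C.lamF i₀ k s0 s1 c : ℝ) *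
        (⟪v (C.freeA c), intVec (C.slot (C.freeB c))⟫ +
          ⟪v (C.freeB c), intVec (C.slot (C.freeA c))⟫) ≤
        ∑ c : Fin C.nF, (C.lamF i₀ k s0 s1 c : ℝ) * (Real.sqrt C.N * (3 / 2 * ε ^ 2)) :=
      Finset.sum_le_sum fun c _ => mul_le_mul_of_nonneg_left (hfreeb c) (by positivity)
    rw [← Finset.sum_mul] at hf
    have ho' : ∑ c : Fin C.nO, (C.lamO i₀ k s0 s1 c : ℝ) *
          ((dotInt (C.ownVec c) (C.ownVec c) : ℝ) / (4 * Real.sqrt C.N) * ε ^ 2) =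
        (∑ c : Fin C.nO, (C.lamO i₀ k s0 s1 c : ℝ) * (dotInt (C.ownVec c) (C.ownVec c) : ℝ)) /
          (4 * Real.sqrt C.N) * ε ^ 2 := by
      rw [Finset.sum_div, Finset.sum_mul]
      refine Finset.sum_congr rfl fun c _ => ?_
      ring
    rw [ho'] at ho
    have hB : (C.BN i₀ k s0 s1 : ℝ) =
        (∑ c : Fin C.nO, (C.lamO i₀ k s0 s1 c : ℝ) * (dotInt (C.ownVec c) (C.ownVec c) : ℝ)) +
        6 * (C.N : ℝ) * ∑ c : Fin C.nF, (C.lamF i₀ k s0 s1 c : ℝ) := by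
      simp [FanCert.BN]
    rw [hB]
    have hsplit : ((∑ c : Fin C.nO, (C.lamO i₀ k s0 s1 c : ℝ) * (dotInt (C.ownVec c) (C.ownVec c) : ℝ)) +
        6 * (C.N : ℝ) * ∑ c : Fin C.nF, (C.lamF i₀ k s0 s1 c : ℝ)) / (4 * Real.sqrt C.N) * ε ^ 2 =
        (∑ c : Fin C.nO, (C.lamO i₀ k s0 s1 c : ℝ) * (dotInt (C.ownVec c) (C.ownVec c) : ℝ)) /
          (4 * Real.sqrt C.N) * ε ^ 2 +
        (∑ c : Fin C.nF, (C.lamF i₀ k s0 s1 c : ℝ)) * (Real.sqrt C.N * (3 / 2 * ε ^ 2)) := by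
      field_simp
      rw [hsqN]
      ring
    rw [hsplit]
    exact add_le_add ho hf
  -- combine: r t ≤ (B_N/(4√N)) ε²;  Cd ‖v‖² ‖D‖² ≤ Cn t²;  ‖v‖² = ε² − ε⁴/4
  have hεz : ε = 0 := by
    by_contra hne
    have hpos : 0 < ε := lt_of_le_of_ne hε0 (Ne.symm hne)
    have hrR : (0 : ℝ) < C.r i₀ k s0 s1 := by exact_mod_cast hr
    have hchain : (C.r i₀ k s0 s1 : ℝ) * t ≤ (C.BN i₀ k s0 s1 : ℝ) / (4 * Real.sqrt C.N) * ε ^ 2 := by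
      rw [← hsum]; exact hup
    have hL0 : 0 ≤ (C.r i₀ k s0 s1 : ℝ) * t := mul_nonneg hrR.le ht0
    have hsq : ((C.r i₀ k s0 s1 : ℝ) * t) ^ 2 ≤ ((C.BN i₀ k s0 s1 : ℝ) / (4 * Real.sqrt C.N) * ε ^ 2) ^ 2 :=
      pow_le_pow_left₀ hL0 hchain 2
    have hR : ((C.BN i₀ k s0 s1 : ℝ) / (4 * Real.sqrt C.N) * ε ^ 2) ^ 2 =
        (C.BN i₀ k s0 s1 : ℝ) ^ 2 / (16 * C.N) * ε ^ 4 := by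
      rw [mul_pow, div_pow, mul_pow, hsqN]; ring
    rw [mul_pow, hR] at hsq
    -- hsq : r² t² ≤ BN²/(16N) ε⁴ ;  hcov : Cd (‖v‖² ‖D‖²) ≤ Cn t²
    rw [hvsq] at hcov
    -- ⇒ Cd r² ‖D‖² (ε² − ε⁴/4) · 16 N ≤ Cn BN² ε⁴
    have k1 : 16 * (C.N : ℝ) * (C.Cd : ℝ) * (C.r i₀ k s0 s1 : ℝ) ^ 2 * ‖D‖ ^ 2 * (ε ^ 2 - ε ^ 4 / 4) ≤
        (C.Cn : ℝ) * (C.BN i₀ k s0 s1 : ℝ) ^ 2 * ε ^ 4 := by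
      have a1 : (C.Cd : ℝ) * (C.r i₀ k s0 s1 : ℝ) ^ 2 * ((ε ^ 2 - ε ^ 4 / 4) * ‖D‖ ^ 2) ≤
          (C.Cn : ℝ) * (C.r i₀ k s0 s1 : ℝ) ^ 2 * t ^ 2 := by
        have := mul_le_mul_of_nonneg_left hcov (sq_nonneg (C.r i₀ k s0 s1 : ℝ))
        linarith
      have a2 : (C.Cn : ℝ) * ((C.r i₀ k s0 s1 : ℝ) ^ 2 * t ^ 2) ≤
          (C.Cn : ℝ) * ((C.BN i₀ k s0 s1 : ℝ) ^ 2 / (16 * C.N) * ε ^ 4) :=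
        mul_le_mul_of_nonneg_left hsq hCnR.le
      have a3 : 16 * (C.N : ℝ) * ((C.Cn : ℝ) * ((C.BN i₀ k s0 s1 : ℝ) ^ 2 / (16 * C.N) * ε ^ 4)) =
          (C.Cn : ℝ) * (C.BN i₀ k s0 s1 : ℝ) ^ 2 * ε ^ 4 := by
        field_simp
      have a12 : (C.Cd : ℝ) * (C.r i₀ k s0 s1 : ℝ) ^ 2 * ((ε ^ 2 - ε ^ 4 / 4) * ‖D‖ ^ 2) ≤
          (C.Cn : ℝ) * ((C.BN i₀ k s0 s1 : ℝ) ^ 2 / (16 * C.N) * ε ^ 4) := by linarith [a1, a2]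
      have a4 := mul_le_mul_of_nonneg_left a12 (show (0:ℝ) ≤ 16 * C.N by positivity)
      rw [a3] at a4
      linarith
    -- rearrange: 16 N Cd r² ‖D‖² ε² ≤ ε⁴ (Cn BN² + 4 N Cd r² ‖D‖²)
    have k2 : 16 * (C.N : ℝ) * (C.Cd : ℝ) * (C.r i₀ k s0 s1 : ℝ) ^ 2 * ‖D‖ ^ 2 ≤
        ε ^ 2 * ((C.Cn : ℝ) * (C.BN i₀ k s0 s1 : ℝ) ^ 2 +
          4 * (C.N : ℝ) * (C.Cd : ℝ) * (C.r i₀ k s0 s1 : ℝ) ^ 2 * ‖D‖ ^ 2) := by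
      have hε2 : 0 < ε ^ 2 := by positivity
      have e : 16 * (C.N : ℝ) * (C.Cd : ℝ) * (C.r i₀ k s0 s1 : ℝ) ^ 2 * ‖D‖ ^ 2 * (ε ^ 2 - ε ^ 4 / 4) =
          ε ^ 2 * (16 * (C.N : ℝ) * (C.Cd : ℝ) * (C.r i₀ k s0 s1 : ℝ) ^ 2 * ‖D‖ ^ 2) -
            ε ^ 2 * (ε ^ 2 * (4 * (C.N : ℝ) * (C.Cd : ℝ) * (C.r i₀ k s0 s1 : ℝ) ^ 2 * ‖D‖ ^ 2)) := by ring
      rw [e] at k1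
      have e2 : (C.Cn : ℝ) * (C.BN i₀ k s0 s1 : ℝ) ^ 2 * ε ^ 4 =
          ε ^ 2 * (ε ^ 2 * ((C.Cn : ℝ) * (C.BN i₀ k s0 s1 : ℝ) ^ 2)) := by ring
      rw [e2] at k1
      have k1' : ε ^ 2 * (16 * (C.N : ℝ) * (C.Cd : ℝ) * (C.r i₀ k s0 s1 : ℝ) ^ 2 * ‖D‖ ^ 2) ≤
          ε ^ 2 * (ε ^ 2 * ((C.Cn : ℝ) * (C.BN i₀ k s0 s1 : ℝ) ^ 2 +
            4 * (C.N : ℝ) * (C.Cd : ℝ) * (C.r i₀ k s0 s1 : ℝ) ^ 2 * ‖D‖ ^ 2)) := by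
        have : ε ^ 2 * (ε ^ 2 * ((C.Cn : ℝ) * (C.BN i₀ k s0 s1 : ℝ) ^ 2 +
            4 * (C.N : ℝ) * (C.Cd : ℝ) * (C.r i₀ k s0 s1 : ℝ) ^ 2 * ‖D‖ ^ 2)) =
            ε ^ 2 * (ε ^ 2 * ((C.Cn : ℝ) * (C.BN i₀ k s0 s1 : ℝ) ^ 2)) +
              ε ^ 2 * (ε ^ 2 * (4 * (C.N : ℝ) * (C.Cd : ℝ) * (C.r i₀ k s0 s1 : ℝ) ^ 2 * ‖D‖ ^ 2)) := by
          ring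
        rw [this]; linarith
      exact le_of_mul_le_mul_left k1' hε2
    -- the ρ-check at i₀ in reals
    have hρr : ((p i₀ : ℝ) / q) ^ 2 * ((C.Cn : ℝ) * (C.BN i₀ k s0 s1 : ℝ) ^ 2 +
        4 * (C.N : ℝ) * (C.Cd : ℝ) * (C.r i₀ k s0 s1 : ℝ) ^ 2 * ‖D‖ ^ 2) ≤
        16 * (C.N : ℝ) * (C.Cd : ℝ) * (C.r i₀ k s0 s1 : ℝ) ^ 2 * ‖D‖ ^ 2 := by
      have hden : (0 : ℝ) < q := by exact_mod_cast hrden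
      have h' : (p i₀ : ℝ) ^ 2 * ((C.Cn : ℝ) * (C.BN i₀ k s0 s1 : ℝ) ^ 2 +
          4 * (C.N : ℝ) * (C.Cd : ℝ) * (C.r i₀ k s0 s1 : ℝ) ^ 2 * ‖D‖ ^ 2) ≤
          16 * (C.N : ℝ) * (C.Cd : ℝ) * (C.r i₀ k s0 s1 : ℝ) ^ 2 * ‖D‖ ^ 2 * (q : ℝ) ^ 2 := by
        rw [← hnD]; exact_mod_cast hrhoR
      rw [div_pow]
      have hd2 : (0 : ℝ) < (q : ℝ) ^ 2 := by positivity
      calc (p i₀ : ℝ) ^ 2 / (q : ℝ) ^ 2 * ((C.Cn : ℝ) * (C.BN i₀ k s0 s1 : ℝ) ^ 2 +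
            4 * (C.N : ℝ) * (C.Cd : ℝ) * (C.r i₀ k s0 s1 : ℝ) ^ 2 * ‖D‖ ^ 2)
          = ((p i₀ : ℝ) ^ 2 * ((C.Cn : ℝ) * (C.BN i₀ k s0 s1 : ℝ) ^ 2 +
              4 * (C.N : ℝ) * (C.Cd : ℝ) * (C.r i₀ k s0 s1 : ℝ) ^ 2 * ‖D‖ ^ 2)) / (q : ℝ) ^ 2 := by ring
        _ ≤ (16 * (C.N : ℝ) * (C.Cd : ℝ) * (C.r i₀ k s0 s1 : ℝ) ^ 2 * ‖D‖ ^ 2 * (q : ℝ) ^ 2) / (q : ℝ) ^ 2 :=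
            div_le_div_of_nonneg_right h' hd2.le
        _ = 16 * (C.N : ℝ) * (C.Cd : ℝ) * (C.r i₀ k s0 s1 : ℝ) ^ 2 * ‖D‖ ^ 2 := by field_simp
    have hM : (0 : ℝ) < (C.Cn : ℝ) * (C.BN i₀ k s0 s1 : ℝ) ^ 2 +
        4 * (C.N : ℝ) * (C.Cd : ℝ) * (C.r i₀ k s0 s1 : ℝ) ^ 2 * ‖D‖ ^ 2 := by
      have : 0 < 4 * (C.N : ℝ) * (C.Cd : ℝ) * (C.r i₀ k s0 s1 : ℝ) ^ 2 * ‖D‖ ^ 2 := by positivity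
      have : 0 ≤ (C.Cn : ℝ) * (C.BN i₀ k s0 s1 : ℝ) ^ 2 := by positivity
      linarith
    have hερ2 : ε ^ 2 < ((p i₀ : ℝ) / q) ^ 2 := pow_lt_pow_left₀ hερ hε0 two_ne_zero
    have k3 := mul_lt_mul_of_pos_right hερ2 hM
    linarith only [k2, k3, hρr]
  funext i
  have : ‖x i - C.s i‖ ≤ 0 := by rw [← hεz]; exact hεi i
  have h0 : x i - C.s i = 0 := norm_le_zero_iff.1 this
  exact sub_eq_zero.1 h0

/-- `dist x o ≥ 1` for a unit vector `x` means `⟪x, o⟫ ≤ ‖o‖²/2`. -/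
theorem inner_le_half_norm_sq_of_one_le_dist' {x o : EuclideanSpace ℝ (Fin 3)} (hx : ‖x‖ = 1)
    (h : 1 ≤ dist x o) : ⟪x, o⟫ ≤ ‖o‖ ^ 2 / 2 := by
  have h1 : 1 ≤ ‖x - o‖ ^ 2 := by rw [← dist_eq_norm]; nlinarith
  have h2 : ‖x - o‖ ^ 2 = ‖x‖ ^ 2 - 2 * ⟪x, o⟫ + ‖o‖ ^ 2 := norm_sub_sq_real x o
  rw [hx] at h2
  linarith

/-- **Distance form with per-ball fan radii.** -/
theorem eq_slots_fanRhoAt_dist {p : Fin m → ℕ} {q : ℕ}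
    (hρ : ∀ i, C.rhoCheckAt i (p i) q = true) (hV : C.check = true)
    {x : Fin m → (EuclideanSpace ℝ (Fin 3))} (hx : ∀ i, ‖x i‖ = 1)
    (hxo : ∀ i, ∀ o ∈ C.ownSet, 1 ≤ dist (x i) o) (hxx : ∀ i j, i ≠ j → 1 ≤ dist (x i) (x j))
    (hclose : ∀ i, dist (x i) (C.s i) < (p i : ℝ) / q) : x = C.s :=
  C.eq_slots_rhoAt hV hρ hx
    (fun i o ho _ => inner_le_half_norm_sq_of_one_le_dist' (hx i) (hxo i o ho))
    (fun i j hij _ => ConeCert.inner_le_half_of_one_le_dist (hx i) (hx j) (hxx i j hij))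
    (fun i => by rw [← dist_eq_norm]; exact hclose i)

/-- The slot map is injective when the integer slots are distinct (one `decide`). -/
theorem s_injective_of_slot (hinj : ∀ i j, C.slot i = C.slot j → i = j) (hV : C.check = true) :
    Function.Injective C.s := by
  obtain ⟨hN, -⟩ := C.check_spec hV
  intro i j hij
  have hc : (Real.sqrt C.N)⁻¹ ≠ 0 := (inv_pos.2 ((Real.sqrt_pos.2 (by exact_mod_cast hN) : (0:ℝ) < Real.sqrt C.N))).ne'
  have h1 : intVec (C.slot i) = intVec (C.slot j) := smul_right_injective _ hc hij
  exact hinj i j (intVec_injective h1)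

/-- **Finset form (E1 ↔ E2 interface) with per-ball fan radii**: `T` = the free balls of an
admissible completion keeping distance `≥ 1` from every listed own/obstacle centre and pairwise,
SLOT-MATCHED to the slot set with tolerance `ρ`, `ρ (s i) ≤ p i / q`, IS the slot set. -/
theorem eq_slotSet_of_slotMatched (hV : C.check = true) {p : Fin m → ℕ} {q : ℕ}
    (hρ : ∀ i, C.rhoCheckAt i (p i) q = true) (hinj : ∀ i j, C.slot i = C.slot j → i = j)
    {ρ : EuclideanSpace ℝ (Fin 3) → ℝ} (hρle : ∀ i, ρ (C.s i) ≤ (p i : ℝ) / q)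
    {T : Finset (EuclideanSpace ℝ (Fin 3))} (hT1 : ∀ t ∈ T, ‖t‖ = 1)
    (hTo : ∀ t ∈ T, ∀ o ∈ C.ownSet, 1 ≤ dist t o)
    (hTT : ∀ t ∈ T, ∀ t' ∈ T, t ≠ t' → 1 ≤ dist t t')
    (hm : SlotMatched ρ T (Finset.univ.image C.s)) : T = Finset.univ.image C.s := by
  classical
  have hsinj : Function.Injective C.s := C.s_injective_of_slot hinj hV
  obtain ⟨e, he⟩ := hm
  have hmem : ∀ i, C.s i ∈ Finset.univ.image C.s := fun i =>
    Finset.mem_image_of_mem _ (Finset.mem_univ i)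
  set y : Fin m → ↥(Finset.univ.image C.s) := fun i => ⟨C.s i, hmem i⟩ with hy
  set x : Fin m → (EuclideanSpace ℝ (Fin 3)) :=
    fun i => ((e.symm (y i) : ↥T) : EuclideanSpace ℝ (Fin 3)) with hx
  have hxT : ∀ i, x i ∈ T := fun i => (e.symm (y i)).prop
  have hxclose : ∀ i, dist (x i) (C.s i) < (p i : ℝ) / q := by
    intro i
    have h := he (e.symm (y i))
    rw [Equiv.apply_symm_apply] at h
    exact lt_of_lt_of_le h (hρle i)
  have hxinj : ∀ i j, i ≠ j → x i ≠ x j := by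
    intro i j hij hxe
    apply hij
    have h1 : e.symm (y i) = e.symm (y j) := Subtype.ext hxe
    have h2 : y i = y j := e.symm.injective h1
    have h3 : C.s i = C.s j := by
      have := congrArg (fun z : ↥(Finset.univ.image C.s) => (z : EuclideanSpace ℝ (Fin 3))) h2
      simpa [hy] using this
    exact hsinj h3
  have hxs : x = C.s :=
    C.eq_slots_fanRhoAt_dist hρ hV (fun i => hT1 _ (hxT i)) (fun i o ho => hTo _ (hxT i) o ho)
      (fun i j hij => hTT _ (hxT i) _ (hxT j) (hxinj i j hij)) hxclose
  ext t
  constructor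
  · intro ht
    obtain ⟨i, -, hi⟩ := Finset.mem_image.1 (e ⟨t, ht⟩).prop
    have h1 : e ⟨t, ht⟩ = y i := Subtype.ext (by rw [hy]; exact hi.symm)
    have h2 : (⟨t, ht⟩ : ↥T) = e.symm (y i) := by rw [← h1, Equiv.symm_apply_apply]
    have h3 : t = x i := by
      have := congrArg (fun z : ↥T => (z : EuclideanSpace ℝ (Fin 3))) h2
      simpa [hx] using this
    rw [h3, hxs]; exact hmem i
  · intro ht
    obtain ⟨i, -, rfl⟩ := Finset.mem_image.1 ht
    have : x i = C.s i := congrFun hxs i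
    rw [← this]; exact hxT i

/-- The slot set in pattern language: `scaledPattern {slot i} N = {s i}`. -/
theorem scaledPattern_slot_eq_image_s :
    scaledPattern (Finset.univ.image C.slot) C.N = Finset.univ.image C.s := by
  classical
  unfold scaledPattern
  rw [Finset.image_image]
  rfl

/-- The listed own/obstacle centres in pattern language: `scaledPattern {ownVec c} N = ownSet`. -/
theorem scaledPattern_ownVec_eq_ownSet :
    scaledPattern (Finset.univ.image C.ownVec) C.N = C.ownSet := by
  classical
  unfold scaledPattern FanCert.ownSet
  rw [Finset.image_image]
  rfl

end FanCert

end Summit.Ventures.Crystal3D.Theorems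

end
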